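import Literature.NumberTheory.Automorphic.Liu2021.ThetaLiftFromLineFrame
import Literature.NumberTheory.Automorphic.UnitaryGroupDatumScaleInvariance
import Literature.NumberTheory.Automorphic.Liu2021.Def411WeilCarriers
import Literature.NumberTheory.Automorphic.ConjugateSelfDualInfinityType
import Literature.AlgebraicGeometry.Liu2021.AdmissibleElement
import HarnessLib

/-!
# Crux `HLiu418`, line LD2 (in-house pay-down of `stub_S1b_facts` = #74 E3nec-hol below G2 `PinnedHolNecessity₂`) — organ C₂'s
# ASSEMBLY «raw archimedean signs + pin `e♮ ∈ Φ_λ` ⇒ `a′·δ′` is `Φ_λ`-admissible», the dictionary step D₂ «`epsOf (a′·δ′) = locF a′`»,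
# and the frame supply F₂ «`ιA : U(H)(𝔸) →* U(diag dV)(𝔸)`, `k ↦ g_𝔸⁻¹ k g_𝔸`, under the SCALED frame `ᵗ(c g)·(t • H)·g = diag dV`»

Cell hodgecm-mathlib (D-0151), FLOOR 0; crux item `HLiu418` = stmt-HodgeConjecture-24832 (route `HCCMUnconditional`); half-A line LD2 (socket
27458 `Cruxes/HLiu418/Lines/F0_AlbCm.lean`, printed stub `stub_S1b_facts : Rogawski1990.curveThetaHodgeTypeNecessity_hol`), docking STRICTLY BELOW
the Paydown cut G2 `F0P5CurveThetaLettersPaydown.PinnedHolNecessity₂` ([Liu2021, Rem. D.5] necessity, label pinned).  Seat LD2-p02 (g0), organ deal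
«C₂ + D₂» of LD2-plan (g0) 2026-09-02.  THEOREMS ONLY (no `def`, no instance, no notation, no named fact, no `sorry`); `--supports
stmt-HodgeConjecture-24832`.  HC_CM is proved only modulo the 7 printed citations (2 remaining: hLiu418, h413) until rung 0 closes; this file
discharges nothing printed — it is kernel glue for the LD2 skeleton (`pinnedHolNecessity₂_of_organs : A₂ → U₂ → C₂ → PinnedHolNecessity₂`).

## What is here (rank-generic where possible; the LD2 line reads it at `N = 2`)

* §1 **`isAdmissibleElement_of_pin_of_archSigns`** — the frame-free heart of organ C₂ at `n = 2` ([Liu2021, App. D Lem. D.2 (3) + (1) as used in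
  Rem. D.5 ∕ the proof of Prop. D.4 (1), p. 130–131]): for a CM type `Φ` (no conjugate pair), a place `w₁` whose distinguished embedding
  `e♮ := w₁.embedding` is PINNED in `Φ`, and `e ∈ L^{×−}`: if `Im e♮(e) < 0` (the raw sign at the `(1,1)`-place — Lem. D.2 (3): «only
  `ω_{1,1}^{−1,−,0}` and `ω_{1,1}^{1,−,0}` are `π^{1,0}`», sign `−` for BOTH weights) and `Im τ′(e) < 0` for every `τ′ ∈ Φ` OFF the place `w₁`
  (the raw table at the compact places — Lem. D.2 (1)), then `e` is `Φ`-admissible ([Liu2021, Def. 4.12]).  The only point: at the place `w₁`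
  the member of `Φ` is `e♮` itself (a CM type never contains `ē♮` together with `e♮`).
  **`isAdmissibleElement_cmType_of_pin_of_archTable`** — the same with `Φ = Φ_λ = hλ.cmType` of a conjugate-symplectic `λ` and the
  off-place hypothesis in the DISJUNCTIVE currency of ★ `Liu2021.meetsThetaLiftFromLine_hol_archTypeAway` («`(exponentAt = −1 ∧ Im < 0) ∨
  (exponentAt = 1 ∧ 0 < Im)`»), read through ★ `mem_cmTypeOf_iff` (`τ′ ∈ Φ_λ ↔ exponentAt hλ.infinityType τ′ < 0`) — the `n = 2` twin of the
  admissibility half of ★ `Liu2021.hasWeightOne_admissible_of_archTypes` (`ThetaLiftFromLineArchAssembly`), WITHOUT the weight conclusion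
  (at `n = 2` the weight is a binder of G2, `hw : HasWeight L λ 1`, and Lem. D.2 (3) does not pin `m₁`).
* §2 **D₂** — `epsOf L⁺ (imagUnitSq L) L (2·imagUnit L)⁻¹ (a′·(2·imagUnit L)⁻¹) = locF L⁺ (imagUnitSq L) a′` is ★
  `Def411WeilCarriers.epsOf_algebraMap_mul` BY NAME (`δ′ := (2·imagUnit L)⁻¹ ≠ 0`); packaged with §1's output and U₂'s output
  «`locF a′ = locF a`» into G2's conclusion `∃ e, IsAdmissibleElement L Φ_λ e ∧ epsOf … e = locF … a` (`exists_admissible_epsOf_eq_locF`).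
* §3 **F₂** — under the curve letters' SCALED frame `formCongr c g (t • H) = diagonal dV` (`t ≠ 0`) there is an adelic transport
  `ιA : (adelicGroupData L⁺ L c N H).Adelic →* U(diagonal dV)(𝔸_{L⁺})` with `↑(ιA k) = g_𝔸⁻¹ · k · g_𝔸` — ★ `cmFrameEquiv` for the matrix `t • H`
  precomposed with the identity `U(H)(𝔸) = U(t • H)(𝔸)` (★ `adelicUnitaryGroup_smul`) and the carrier bridge ★ `cmAdelicEquiv`; and
  `[U(diagonal dV)]` is compact as soon as `diagonal dV` is positive definite at one complex embedding (★
  `compactSpace_adelicGroupData_automorphicQuotient_of_posDef`), which the letters' binder «definite off the place of `ι`» supplies at a place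
  `≠ w(ι)` (★ `exists_infinitePlace_ne`, `[L:ℚ] ≥ 4`).  Rank-generic `N`; the twin of ★ `Liu2021.adelicFrameCompact` (n = 3, unscaled frame).

## References
* [Liu2021] Y. Liu, *Fourier–Jacobi cycles and arithmetic relative trace formula*, Camb. J. Math. 9 (2021) = arXiv:2102.11518: App. D Lem. D.2 (1), (3)
  (p. 127, l. 5282–5286), proof of Prop. D.4 (1) (p. 130–131), Rem. D.5 (p. 131); Def. 4.3, Def. 4.12 (p. 47); App. D §D.1 Step 1 (l. 5215–5217).
* [PlatonovRapinchuk1994] V. Platonov, A. Rapinchuk, *Algebraic Groups and Number Theory* (1994), §2.3; §5.3 Thm. 5.5.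
* [Mok2014] C. P. Mok, Mem. AMS 235 (2015), §1 Notation p. 5.
-/

set_option autoImplicit false
-- the mandated namespace has the single-problem summit's repeated segment (`HodgeConjecture.HodgeConjecture`)
set_option linter.dupNamespace false

noncomputable section

open NumberField NumberField.InfinitePlace MeasureTheory IsDedekindDomain
open scoped Matrix ComplexOrder

namespace Summit.HodgeConjecture.HodgeConjecture.Cruxes.HLiu418.F0LD2ArchAdmissibleAssembly

open Literature.NumberTheory.Automorphic Literature.NumberTheory.Automorphic.UnitaryGroup
open Literature.NumberTheory.Automorphic.IdeleClassGroup
open Literature.NumberTheory.Automorphic.Liu2021 Literature.NumberTheory.Automorphic.Liu2021.Def411WeilCarriers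
open Literature.NumberTheory.GelbartRogawski1991.UnitaryDualPair
open Literature.NumberTheory.GaloisRepresentations
open Literature.AlgebraicGeometry.Liu2021 (IsAdmissibleElement isAdmissibleElement_iff)
open Literature.AlgebraicGeometry.Motives (CMType)

/-! ## §1 The frame-free heart of C₂: pin + raw archimedean signs ⇒ admissibility -/

section Core

variable {L : Type} [Field L] [NumberField L] [IsCMField L]

/-- **C₂, frame-free form** ([Liu2021, Rem. D.5 via Lem. D.2 (3) at the `(1,1)`-place and Lem. D.2 (1) at the compact places]): let `Φ` be a CM
type of the CM field `L`, `w₁` a place whose distinguished embedding `e♮ = w₁.embedding` lies in `Φ` (the PIN «`τ′₁ ∈ Φ_μ`» of [Liu2021, Prop. D.4 (1)]),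
and `e ∈ L^{×−}` (`e ≠ 0`, `ē = −e`).  If `Im e♮(e) < 0` and `Im τ′(e) < 0` for every `τ′ ∈ Φ` off the place `w₁`, then `e` is `Φ`-admissible in the
sense of [Liu2021, Def. 4.12] (`Im τ′(e) < 0` for EVERY `τ′ ∈ Φ`): the member of `Φ` above `w₁` is `e♮`, since `Φ` contains no conjugate pair.
[cite: Liu2021, App. D Rem. D.5 (p. 131); Lem. D.2 (1), (3) (p. 127); Def. 4.12 (p. 47)] -/
theorem isAdmissibleElement_of_pin_of_archSigns (Φ : CMType L) (w₁ : InfinitePlace L) {e : L}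
    (he0 : e ≠ 0) (hskew : IsCMField.complexConj L e = -e) (hpin : w₁.embedding ∈ Φ.1)
    (hAt : (w₁.embedding e).im < 0)
    (hAway : ∀ τ' : L →+* ℂ, InfinitePlace.mk τ' ≠ w₁ → τ' ∈ Φ.1 → (τ' e).im < 0) :
    IsAdmissibleElement L Φ.1 e := by
  refine ⟨he0, hskew, fun τ' hτ' => ?_⟩
  by_cases hw : InfinitePlace.mk τ' = w₁
  · -- above `w₁` the member of `Φ` is `e♮ = w₁.embedding`
    rcases InfinitePlace.embedding_mk_eq τ' with h | h
    · rw [← h, hw]; exact hAt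
    · -- `w₁.embedding = conjugate τ'`: then both `τ'` and `conjugate τ'` lie in `Φ` — impossible for a CM type
      exfalso
      rw [hw] at h
      exact (Φ.2 τ').1 hτ' (h ▸ hpin)
  · exact hAway τ' hw hτ'

/-- **C₂ for `Φ = Φ_λ`, in the table currency of the T5 letters** ([Liu2021, Rem. D.5; Lem. D.2 (1), (3); Def. 4.3]): for a conjugate-symplectic
`λ` with CM type `Φ_λ = hλ.cmType = {τ′ ∣ exponentAt hλ.infinityType τ′ < 0}` and a place `w₁` with `w₁.embedding ∈ Φ_λ`, an element
`e ∈ L^{×−}` with `Im (w₁.embedding e) < 0` and, at every `τ′` off `w₁`, the raw parameters `(m, sign) ∈ {(−1, −), (1, +)}`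
(«`(exponentAt = −1 ∧ Im τ′(e) < 0) ∨ (exponentAt = 1 ∧ 0 < Im τ′(e))`», the conclusion shape of ★ `Liu2021.meetsThetaLiftFromLine_hol_archTypeAway`)
is `Φ_λ`-admissible.  (`n = 2` twin of the admissibility half of ★ `Liu2021.hasWeightOne_admissible_of_archTypes`.)
[cite: Liu2021, App. D Rem. D.5 (p. 131); Lem. D.2 (1), (3) (p. 127); Def. 4.3; Def. 4.12 (p. 47)] -/
theorem isAdmissibleElement_cmType_of_pin_of_archTable {lam : IdeleClassGroup L →ₜ* Circle} (hlam : IsConjugateSymplectic L lam)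
    (w₁ : InfinitePlace L) {e : L} (he0 : e ≠ 0) (hskew : IsCMField.complexConj L e = -e)
    (hpin : w₁.embedding ∈ hlam.cmType.1) (hAt : (w₁.embedding e).im < 0)
    (hAway : ∀ τ' : L →+* ℂ, InfinitePlace.mk τ' ≠ w₁ →
      (exponentAt hlam.infinityType τ' = -1 ∧ (τ' e).im < 0) ∨ (exponentAt hlam.infinityType τ' = 1 ∧ 0 < (τ' e).im)) :
    IsAdmissibleElement L hlam.cmType.1 e := by
  refine isAdmissibleElement_of_pin_of_archSigns hlam.cmType w₁ he0 hskew hpin hAt fun τ' hw hτ' => ?_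
  have hneg : exponentAt hlam.infinityType τ' < 0 := hτ'
  rcases hAway τ' hw with ⟨-, h2⟩ | ⟨h1, -⟩
  · exact h2
  · rw [h1] at hneg; norm_num at hneg

end Core

/-! ## §2 D₂: the collection of the line discriminant `a′·δ′`, and G2's conclusion packaged -/

section Dictionary

variable (L : Type) [Field L] [NumberField L] [IsCMField L]

/-- `δ′ = (2·imagUnit L)⁻¹ ≠ 0`. [cite: Liu2021, App. D §D.1 Step 1 (l. 5217)] -/
theorem lineDiscUnit_ne_zero : (2 * imagUnit L)⁻¹ ≠ (0 : L) :=
  inv_ne_zero (mul_ne_zero two_ne_zero (imagUnit_ne_zero L))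

/-- **D₂ — the collection generated by `e′ = a′·δ′` is the collection of the line `⟨a′⟩`**: `epsOf L⁺ (imagUnitSq L) L δ′ (a′·δ′) = locF L⁺ (imagUnitSq L) a′`
(★ `Def411WeilCarriers.epsOf_algebraMap_mul` at `δ := δ′ = (2·imagUnit L)⁻¹`; `L/L⁺` is quadratic because `L` is CM).
[cite: Liu2021, Def. 4.12 (l. 2105, p. 47); App. D §D.1 Step 1 (l. 5215)] -/
theorem epsOf_lineDisc (a' : (↥(maximalRealSubfield L))ˣ) :
    epsOf (↥(maximalRealSubfield L)) (imagUnitSq L) L (2 * imagUnit L)⁻¹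
        (algebraMap (↥(maximalRealSubfield L)) L a' * (2 * imagUnit L)⁻¹) =
      locF (↥(maximalRealSubfield L)) (imagUnitSq L) a' :=
  epsOf_algebraMap_mul (↥(maximalRealSubfield L)) (imagUnitSq L) L (2 * imagUnit L)⁻¹ (lineDiscUnit_ne_zero L) a'

variable {L} in
/-- **G2's conclusion from the organs' outputs**: if `a′·δ′` is `Φ`-admissible (organ C₂) and the lines `⟨a′⟩`, `⟨a⟩` have the same collection
(organ U₂, «`locF a′ = locF a`»), then `∃ e, IsAdmissibleElement L Φ e ∧ epsOf … δ′ e = locF … a` — the body of the conclusion of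
`F0P5CurveThetaLettersPaydown.PinnedHolNecessity₂`, with the witness `e := a′·δ′` (D₂). [cite: Liu2021, App. D Rem. D.5 (p. 131); Def. 4.12 (p. 47)] -/
theorem exists_admissible_epsOf_eq_locF {Φ : Set (L →+* ℂ)} {a a' : (↥(maximalRealSubfield L))ˣ}
    (hadm : IsAdmissibleElement L Φ (algebraMap (↥(maximalRealSubfield L)) L a' * (2 * imagUnit L)⁻¹))
    (hcl : locF (↥(maximalRealSubfield L)) (imagUnitSq L) a' = locF (↥(maximalRealSubfield L)) (imagUnitSq L) a) :
    ∃ e : L, IsAdmissibleElement L Φ e ∧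
      epsOf (↥(maximalRealSubfield L)) (imagUnitSq L) L (2 * imagUnit L)⁻¹ e = locF (↥(maximalRealSubfield L)) (imagUnitSq L) a :=
  ⟨_, hadm, (epsOf_lineDisc L a').trans hcl⟩

/-- **The line discriminant `a′·δ′` is a non-zero element of `L^{×−}`** (`a′ ∈ L⁺`, `δ̄′ = −δ′`): the two structural clauses of `IsAdmissibleElement`
for the witness of D₂ (cf. ★ `Liu2021.lineDisc_ne_zero_and_skew`, restated here to keep this file's imports below the T5 seam).
[cite: Liu2021, App. D §D.1 Step 1 (l. 5217); Def. 4.12 (p. 47)] -/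
theorem lineDisc_ne_zero_and_skew (a' : (↥(maximalRealSubfield L))ˣ) :
    algebraMap (↥(maximalRealSubfield L)) L a' * (2 * imagUnit L)⁻¹ ≠ 0 ∧
      IsCMField.complexConj L (algebraMap (↥(maximalRealSubfield L)) L a' * (2 * imagUnit L)⁻¹) =
        -(algebraMap (↥(maximalRealSubfield L)) L a' * (2 * imagUnit L)⁻¹) := by
  refine ⟨mul_ne_zero ((map_ne_zero (algebraMap (↥(maximalRealSubfield L)) L)).2 a'.ne_zero) (lineDiscUnit_ne_zero L), ?_⟩
  have ha : IsCMField.complexConj L (algebraMap (↥(maximalRealSubfield L)) L a') = algebraMap (↥(maximalRealSubfield L)) L a' :=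
    IsCMField.complexConj_apply_eq_self L (a' : ↥(maximalRealSubfield L))
  rw [map_mul, map_inv₀, map_mul, map_ofNat, complexConj_imagUnit, ha, mul_neg, inv_neg, mul_neg]

end Dictionary

/-! ## §3 F₂: the adelic frame transport under the SCALED frame, and compactness of `[U(diagonal dV)]` -/

section Frame

variable (L : Type) [Field L] [NumberField L] [IsCMField L] (N : ℕ) (H : Matrix (Fin N) (Fin N) L) (dV : Fin N → L)
  (t : L) (ht : t ≠ 0) (g : GL (Fin N) L)
  (hg : formCongr ((IsCMField.complexConj L : L ≃ₐ[↥(maximalRealSubfield L)] L) : L →+* L) g (t • H) = Matrix.diagonal dV)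

include hg in
/-- The scaled frame hypothesis of the curve letters, in the unscaled-congruence spelling of ★ `cmFrameEquiv` ∕ ★ `cmAdelicFrameTransport` for the
matrix `t • H`: `ᵗ(c̄ g) · (t • H) · g = diagonal dV` (the letters' `(complexConj L : L →+* L)` IS `cmConjRingHom L`, cf. ★
`S1BettiSliceExclusion.coe_complexConj_eq_cmConjRingHom`). [cite: PlatonovRapinchuk1994, §2.3] -/
theorem frame_smul_eq :
    ((g : Matrix (Fin N) (Fin N) L).map (cmConjRingHom L))ᵀ * (t • H) * (g : Matrix (Fin N) (Fin N) L) = Matrix.diagonal dV := by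
  have h : ((IsCMField.complexConj L : L ≃ₐ[↥(maximalRealSubfield L)] L) : L →+* L) = cmConjRingHom L := RingHom.ext fun _ => rfl
  rw [← h]; exact hg

include ht hg in
/-- **F₂ (transport) — under the scaled frame `ᵗ(c̄ g)·(t • H)·g = diagonal dV`, `t ≠ 0`, there is an adelic transport
`ιA : U(H)(𝔸_{L⁺}) →* U(diagonal dV)(𝔸_{L⁺})` with `↑(ιA k) = g_𝔸⁻¹ · k · g_𝔸`** — ★ `cmFrameEquiv` for `t • H` after the identity
`U(H)(𝔸) = U(t • H)(𝔸)` (★ `adelicUnitaryGroup_smul`: the unitary group only sees the similarity class of the form) and the carrier bridge ★ `cmAdelicEquiv`.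
Rank-generic; the pin is the binder `hιA` of the T5 letters ∕ the LD2 organs. [cite: PlatonovRapinchuk1994, §2.3] [cite: Mok2014, §1 Notation p. 5] -/
theorem exists_adelicFrameTransport_smul :
    ∃ ιA : (adelicGroupData (↥(maximalRealSubfield L)) L (IsCMField.complexConj L) N H).Adelic →*
        ↥(UnitaryGroup.adelic (↥(maximalRealSubfield L)) L (IsCMField.complexConj L) N (Matrix.diagonal dV)),
      ∀ k, ((ιA k : ↥(UnitaryGroup.adelic (↥(maximalRealSubfield L)) L (IsCMField.complexConj L) N (Matrix.diagonal dV))) :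
            GL (Fin N) (AdeleRing (𝓞 L) L)) =
          (toAdeleGL L g)⁻¹ * adelicVal (↥(maximalRealSubfield L)) L (IsCMField.complexConj L) N H k * toAdeleGL L g := by
  have hg' := frame_smul_eq L N H dV t g hg
  refine ⟨(cmFrameEquiv L g (t • H) dV hg').toMonoidHom.comp
      ((MulEquiv.subgroupCongr (adelicUnitaryGroup_smul L N ht H).symm).toMonoidHom.comp
        (cmAdelicEquiv L N H).symm.toMonoidHom), fun k => ?_⟩
  show ((cmFrameEquiv L g (t • H) dV hg' (MulEquiv.subgroupCongr (adelicUnitaryGroup_smul L N ht H).symm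
      ((cmAdelicEquiv L N H).symm k)) : ↥(UnitaryGroup.adelic (↥(maximalRealSubfield L)) L (IsCMField.complexConj L) N
        (Matrix.diagonal dV))) : GL (Fin N) (AdeleRing (𝓞 L) L)) = _
  rw [coe_cmFrameEquiv]
  rfl

/-- **F₂ (compactness) — `[U(diagonal dV)]` is compact when `diagonal dV` is positive definite at the complex places off `w(ι)` and `[L:ℚ] ≥ 4`**:
there is a complex embedding `τ` off the place of `ι` (★ `exists_infinitePlace_ne`), at which `diagonal dV` is definite, so the automorphic quotient of
`U(diagonal dV)` is compact (★ `compactSpace_adelicGroupData_automorphicQuotient_of_posDef`; anisotropic ⇒ compact, [PlatonovRapinchuk1994, §5.3 Thm. 5.5]).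
Stated on the T5 seam's quotient `U(diag dV)(𝔸) ⧸ U(diag dV)(L⁺)` (the datum's `A_G = ⊥`). [cite: PlatonovRapinchuk1994, §5.3 Thm. 5.5] -/
theorem compactSpace_quotient_diagonal_of_posDef (ι : L →+* ℂ)
    (hpos : ∀ τ' : L →+* ℂ, InfinitePlace.mk τ' ≠ InfinitePlace.mk ι → ((Matrix.diagonal dV).map τ').PosDef)
    (h4 : 4 ≤ Module.finrank ℚ L) :
    CompactSpace (↥(UnitaryGroup.adelic (↥(maximalRealSubfield L)) L (IsCMField.complexConj L) N (Matrix.diagonal dV)) ⧸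
      (UnitaryGroup.toAdelic (↥(maximalRealSubfield L)) L (IsCMField.complexConj L) N (Matrix.diagonal dV)).range) := by
  obtain ⟨τ, hτ⟩ := UnitaryGroup.exists_infinitePlace_ne L h4 ι
  have hC : CompactSpace (↥(UnitaryGroup.adelic (↥(maximalRealSubfield L)) L (IsCMField.complexConj L) N (Matrix.diagonal dV)) ⧸
      (⊥ ⊔ (UnitaryGroup.toAdelic (↥(maximalRealSubfield L)) L (IsCMField.complexConj L) N (Matrix.diagonal dV)).range)) :=
    UnitaryGroup.compactSpace_adelicGroupData_automorphicQuotient_of_posDef L N (Matrix.diagonal dV) τ (hpos τ hτ)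
  rwa [bot_sup_eq] at hC

include ht hg in
/-- **F₂ packaged** (the `∃ ιA, pin ∧ compact` shape of ★ `Liu2021.adelicFrameCompact`, under the curve letters' scaled frame and definiteness binder):
rank-generic. [cite: PlatonovRapinchuk1994, §2.3; §5.3 Thm. 5.5] [cite: Mok2014, §1 Notation p. 5] -/
theorem adelicFrameCompact_smul (ι : L →+* ℂ)
    (hpos : ∀ τ' : L →+* ℂ, InfinitePlace.mk τ' ≠ InfinitePlace.mk ι → ((Matrix.diagonal dV).map τ').PosDef)
    (h4 : 4 ≤ Module.finrank ℚ L) :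
    ∃ ιA : (adelicGroupData (↥(maximalRealSubfield L)) L (IsCMField.complexConj L) N H).Adelic →*
        ↥(UnitaryGroup.adelic (↥(maximalRealSubfield L)) L (IsCMField.complexConj L) N (Matrix.diagonal dV)),
      (∀ k, ((ιA k : ↥(UnitaryGroup.adelic (↥(maximalRealSubfield L)) L (IsCMField.complexConj L) N (Matrix.diagonal dV))) :
            GL (Fin N) (AdeleRing (𝓞 L) L)) =
          (toAdeleGL L g)⁻¹ * adelicVal (↥(maximalRealSubfield L)) L (IsCMField.complexConj L) N H k * toAdeleGL L g) ∧
      CompactSpace (↥(UnitaryGroup.adelic (↥(maximalRealSubfield L)) L (IsCMField.complexConj L) N (Matrix.diagonal dV)) ⧸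
        (UnitaryGroup.toAdelic (↥(maximalRealSubfield L)) L (IsCMField.complexConj L) N (Matrix.diagonal dV)).range) := by
  obtain ⟨ιA, hιA⟩ := exists_adelicFrameTransport_smul L N H dV t ht g hg
  exact ⟨ιA, hιA, compactSpace_quotient_diagonal_of_posDef L N dV ι hpos h4⟩

end Frame

end Summit.HodgeConjecture.HodgeConjecture.Cruxes.HLiu418.F0LD2ArchAdmissibleAssembly

end
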